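import Summits.QuantumFields.YangMills.Theorems.UnitScaleTiltHistoryTailOneSupplier
import Summits.QuantumFields.YangMills.Theorems.AlphaInputsT3ACv3RecordFL
import HarnessLib

/-!
# `AlphaInputsT3ACv3RecordFLOneSupplier` — STRATEGY B for 2′ (the NON-χ display of stmt-QuantumFields-19935): **THE (FL)-DISPLAY `PinnedPartsT3ACRecFL L` AND THE REGISTERED
# 2′ TEXT `AlphaInputsT3ACv3Rec L` FROM (T) AT ANY CONSTANTS PLUS THE SUPPLIER ROWS** — the 19935 twin of ★w5-19936 g0's `UnitScaleTiltHistoryTailOneSupplier` §3 — lane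
# `pub-balaban3d`, seat alpha-2 (g6)

WHY.  The 19936 cell's one-supplier theorems (`HistoryTailOneSupplier.pinnedPartsT3ACRecFLChi_of_thm1_rows`, `…_of_thm1_fineLifts_dataRows`, …) serve the χ display of 2′χ.
The display of record of 2′ (item 19935, this seat's g4 `…v3RecordFL`: ★★★ `alphaInputsT3ACv3Rec_of_pinnedPartsRecFL : PinnedPartsT3ACRecFL L → AlphaInputsT3ACv3Rec L`) has
the SAME shape with the plain data rows `DataRowsT3X` in place of `DataRowsT3XChi`; its (FL) conjunct is the very `InnerFineLiftsT3 … 𝔠.B₃` the (FL) team's regional Newton lift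
will deliver.  THIS FILE types the missing knit, so that when (FL) lands as a theorem (in any constant `B_FL ≤ B₃`, via `innerFineLiftsT3_mono`) and NODE O serves the plain data
rows, 2′ closes by `exact`: ★★ `pinnedPartsT3ACRecFL_of_thm1_rows` (verbatim the χ proof with `DataRowsT3X`), ★★ `alphaInputsT3ACv3Rec_of_thm1_rows`, and the (FL)-split form
★★ `alphaInputsT3ACv3Rec_of_thm1_fineLifts_dataRows` (one (FL) theorem per record with `B_FL ≤ B₃` + the plain data rows).
HONEST FRAMING.  Bookkeeping∕composition of landed theorems (restriction of quantifiers, one arithmetic witness); (T), (FL) and the data rows stay HYPOTHESES; count-neutral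
helper toward R3 2′ (`stub_laneRecordsV3`, item 19935 — NOT closed here); registry untouched; def-free.  YM₃ on the three-torus is rung R3 of the programme, not the Clay
problem: nothing here is about d = 4, infinite volume, or a mass gap.

References: T. Bałaban, Commun. Math. Phys. 102 (1985) 277–309 [Balaban1985Variational] (Thm 1 (6)–(8) pp.278–279); Commun. Math. Phys. 102 (1985) 255–275 [Balaban1985UV3]
((7) p.257, (40)–(42) p.266, (47) p.267, (68) p.273, Thm 2 p.272).
-/

set_option autoImplicit false

noncomputable section

namespace Summit.QuantumFields.YangMills.Theorems.RecordFLOneSupplier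

open MeasureTheory Set
open scoped Matrix.Norms.L2Operator
open Literature.MathematicalPhysics.QuantumFieldTheory.Balaban1983to89
open Literature.MathematicalPhysics.QuantumFieldTheory.Balaban1983to89.T3ContinuumYM3Torus
open Literature.MathematicalPhysics.QuantumFieldTheory.Balaban1983to89.T3PrintedMinimiserExistence (Thm1GlobalMinAt)
open Literature.MathematicalPhysics.QuantumFieldTheory.Balaban1983to89.ExpMeanLog (deltaSU deltaSU_pos)
open Literature.MathematicalPhysics.QuantumFieldTheory.Balaban1985CMP102.Setting
open Summit.QuantumFields.Balaban3D.Carriers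
open Summit.QuantumFields.Balaban3D.Proofs.Primitives
open Summit.QuantumFields.Balaban3D.Proofs.Thresholds (Q0 Q0_pos)
open Summit.QuantumFields.YangMills.Theorems.HistoryTailOneSupplier (exists_small_window innerFineLiftsT3_mono)
open B7Prop2Explicit (C0 C0_pos)

/-- ★★ **THE 2′ DISPLAY OF RECORD `PinnedPartsT3ACRecFL L` FROM (T) AT ANY CONSTANTS AND THE SUPPLIER ROWS** (the 19935 twin of `pinnedPartsT3ACRecFLChi_of_thm1_rows`): `hT` —
Thm 1 (global reading) at SOME `(a₀, a₁, B₃) > 0`; `hrows` — for every `B ≥ B₀` with `1 ≤ 2B` and every `(a₀, a₁) ∈ (0, A₀] × (0, A₁]` with `B·a₁ ≤ a₀`, the two small-`a₁` rows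
and `Thm1GlobalMinAt L a₀ a₁ B` (usable), thresholds beyond which every profile is served by a record with exactly that profile, `B₃ = B`, the three `C68`-rows, `7L + 3 ≤ M₁`,
and per family (FL) `InnerFineLiftsT3 … B₃` and the PLAIN data rows `DataRowsT3X` for some pinned trivial-history minimiser family whenever one exists.
[cite: Balaban1985Variational, Thm 1 (6)–(8) pp.278–279; Balaban1985UV3, (7) p.257, (40)–(42) p.266, (68) p.273 and Thm 2 p.272] -/
theorem pinnedPartsT3ACRecFL_of_thm1_rows {L : ℕ} (hL : 1 < L)
    (hT : ∃ a₀ a₁ B₃ : ℝ, 0 < a₀ ∧ 0 < a₁ ∧ 0 < B₃ ∧ Thm1GlobalMinAt L a₀ a₁ B₃)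
    {B₀ A₀ A₁ : ℝ} (hA₀ : 0 < A₀) (hA₁ : 0 < A₁)
    (hrows : ∀ (B a₀ a₁ : ℝ), B₀ ≤ B → 1 ≤ 2 * B → 0 < a₀ → a₀ ≤ A₀ → 0 < a₁ → a₁ ≤ A₁ → B * a₁ ≤ a₀ →
      (143 * ((((3 + 4 : ℕ) : ℝ)) ^ 2 / 4) ^ 2) * (2 * (B * a₁)) ≤ 1 / 3 →
      2 * (2 * (B * a₁)) ≤ 2 * deltaSU (Fin 2) / (((3 + 4) * L : ℕ) : ℝ) ^ 2 →
      Thm1GlobalMinAt L a₀ a₁ B →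
      ∃ (b₁ p₁ : ℝ), ∀ (b₀ p₀ : ℝ), b₁ ≤ b₀ → p₁ ≤ p₀ →
        ∃ 𝔠 : AlphaConsts L (suGroupModel 2).N, 𝔠.b₀ = b₀ ∧ 𝔠.p₀ = p₀ ∧ 𝔠.B₃ = B ∧
          4 * 𝔠.B₃ * (L : ℝ) ^ 2 * avgWindowFactor L ≤ 𝔠.C68 ∧
          Real.exp (𝔠.p₀ - 1) ≤ 3 * C0 3 * 𝔠.C68 * (𝔠.b₀ * Q0 𝔠.p₀) ∧
          (𝔠.b₀ * Q0 𝔠.p₀) * (2 * (L : ℝ) ^ 2 * avgWindowFactor L) ^ 2 ≤ 3 * C0 3 * 𝔠.C68 * a₁ ^ 2 ∧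
          7 * L + 3 ≤ 𝔠.M₁ ∧
          ∀ (F : T3Family) (hF : F.L = L),
            (∀ (γ : ℝ) (hγ : 0 < γ) (hγ1 : γ ≤ (min (hF ▸ 𝔠).gamma0 1) ^ 2) (K : ℕ),
              AlphaInputsT3AC.InnerFineLiftsT3 F (hF ▸ 𝔠) γ hγ hγ1 K (hF ▸ 𝔠).B₃) ∧
            (∀ (γ : ℝ) (hγ : 0 < γ) (hγ1 : γ ≤ (min (hF ▸ 𝔠).gamma0 1) ^ 2) (K : ℕ),
              (∃ Ut : (k : ℕ) → GaugeField (F.P K) k (Matrix.specialUnitaryGroup (Fin 2) ℂ) →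
                  GaugeField (F.P K) 0 (Matrix.specialUnitaryGroup (Fin 2) ℂ),
                AlphaInputsT3AC.TrivMinimiserRowsT3 F (hF ▸ 𝔠) γ hγ hγ1 a₀ a₁ K Ut) →
              ∃ Ut : (k : ℕ) → GaugeField (F.P K) k (Matrix.specialUnitaryGroup (Fin 2) ℂ) →
                  GaugeField (F.P K) 0 (Matrix.specialUnitaryGroup (Fin 2) ℂ),
                AlphaInputsT3AC.TrivMinimiserRowsT3 F (hF ▸ 𝔠) γ hγ hγ1 a₀ a₁ K Ut ∧
                  AlphaInputsT3AC.DataRowsT3X F (hF ▸ 𝔠) γ hγ hγ1 K Ut)) :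
    AlphaInputsT3AC.PinnedPartsT3ACRecFL L := by
  obtain ⟨aT₀, aT₁, BT, haT₀, haT₁, hBT, hT⟩ := hT
  -- the record's `B₃`: above 19200's `B₃`, the supplier's floor and `½`
  set B : ℝ := max (max BT B₀) (1 / 2) with hB_def
  have hBT_le : BT ≤ B := (le_max_left _ _).trans (le_max_left _ _)
  have hB₀_le : B₀ ≤ B := (le_max_right _ _).trans (le_max_left _ _)
  have hBhalf : 1 / 2 ≤ B := le_max_right _ _
  have hBpos : 0 < B := lt_of_lt_of_le (by norm_num) hBhalf
  have h2B : 1 ≤ 2 * B := by linarith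
  -- the [7] constants inside the box and below 19200's
  obtain ⟨a₀, a₁, ha₀, ha₀A, ha₁, ha₁A, hwin, hA3, hA2⟩ :=
    exists_small_window hL hBpos (lt_min hA₀ haT₀) (lt_min hA₁ haT₁)
  have hT' : Thm1GlobalMinAt L a₀ a₁ B :=
    MinimiserPin.thm1GlobalMinAt_mono
      (MinimiserPin.thm1GlobalMinAt_anti hT (ha₀A.trans (min_le_right _ _)) (ha₁A.trans (min_le_right _ _))) le_rfl hBT_le
  obtain ⟨b₁, p₁, hrec⟩ := hrows B a₀ a₁ hB₀_le h2B ha₀ (ha₀A.trans (min_le_left _ _)) ha₁ (ha₁A.trans (min_le_left _ _))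
    hwin hA3 hA2 hT'
  refine ⟨b₁, p₁, fun b₀ p₀ hb hp => ?_⟩
  obtain ⟨𝔠, h1, h2, hB3, s1, s2, s3, s4, hFO⟩ := hrec b₀ p₀ hb hp
  refine ⟨𝔠, a₀, a₁, h1, h2, ha₀, ha₁, by rw [hB3]; exact hwin, by rw [hB3]; exact hA3, by rw [hB3]; exact hA2,
    by rw [hB3]; exact h2B, s1, s2, s3, s4, by rw [hB3]; exact hT', fun F hF => hFO F hF⟩

/-- ★★ **THE REGISTERED 2′ TEXT `AlphaInputsT3ACv3Rec L` FROM (T) AT ANY CONSTANTS AND THE SUPPLIER ROWS** (§ above through this seat's g4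
`alphaInputsT3ACv3Rec_of_pinnedPartsRecFL`). [cite: Balaban1985UV3, Thm 2 p.272 and (47) p.267; Balaban1985Variational, Thm 1 (8) p.279] -/
theorem alphaInputsT3ACv3Rec_of_thm1_rows {L : ℕ} (hL : 1 < L)
    (hT : ∃ a₀ a₁ B₃ : ℝ, 0 < a₀ ∧ 0 < a₁ ∧ 0 < B₃ ∧ Thm1GlobalMinAt L a₀ a₁ B₃)
    {B₀ A₀ A₁ : ℝ} (hA₀ : 0 < A₀) (hA₁ : 0 < A₁)
    (hrows : ∀ (B a₀ a₁ : ℝ), B₀ ≤ B → 1 ≤ 2 * B → 0 < a₀ → a₀ ≤ A₀ → 0 < a₁ → a₁ ≤ A₁ → B * a₁ ≤ a₀ →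
        (143 * ((((3 + 4 : ℕ) : ℝ)) ^ 2 / 4) ^ 2) * (2 * (B * a₁)) ≤ 1 / 3 →
        2 * (2 * (B * a₁)) ≤ 2 * deltaSU (Fin 2) / (((3 + 4) * L : ℕ) : ℝ) ^ 2 →
        Thm1GlobalMinAt L a₀ a₁ B →
        ∃ (b₁ p₁ : ℝ), ∀ (b₀ p₀ : ℝ), b₁ ≤ b₀ → p₁ ≤ p₀ →
          ∃ 𝔠 : AlphaConsts L (suGroupModel 2).N, 𝔠.b₀ = b₀ ∧ 𝔠.p₀ = p₀ ∧ 𝔠.B₃ = B ∧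
            4 * 𝔠.B₃ * (L : ℝ) ^ 2 * avgWindowFactor L ≤ 𝔠.C68 ∧
            Real.exp (𝔠.p₀ - 1) ≤ 3 * C0 3 * 𝔠.C68 * (𝔠.b₀ * Q0 𝔠.p₀) ∧
            (𝔠.b₀ * Q0 𝔠.p₀) * (2 * (L : ℝ) ^ 2 * avgWindowFactor L) ^ 2 ≤ 3 * C0 3 * 𝔠.C68 * a₁ ^ 2 ∧
            7 * L + 3 ≤ 𝔠.M₁ ∧
            ∀ (F : T3Family) (hF : F.L = L),
              (∀ (γ : ℝ) (hγ : 0 < γ) (hγ1 : γ ≤ (min (hF ▸ 𝔠).gamma0 1) ^ 2) (K : ℕ),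
                AlphaInputsT3AC.InnerFineLiftsT3 F (hF ▸ 𝔠) γ hγ hγ1 K (hF ▸ 𝔠).B₃) ∧
              (∀ (γ : ℝ) (hγ : 0 < γ) (hγ1 : γ ≤ (min (hF ▸ 𝔠).gamma0 1) ^ 2) (K : ℕ),
                (∃ Ut : (k : ℕ) → GaugeField (F.P K) k (Matrix.specialUnitaryGroup (Fin 2) ℂ) →
                    GaugeField (F.P K) 0 (Matrix.specialUnitaryGroup (Fin 2) ℂ),
                  AlphaInputsT3AC.TrivMinimiserRowsT3 F (hF ▸ 𝔠) γ hγ hγ1 a₀ a₁ K Ut) →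
                ∃ Ut : (k : ℕ) → GaugeField (F.P K) k (Matrix.specialUnitaryGroup (Fin 2) ℂ) →
                    GaugeField (F.P K) 0 (Matrix.specialUnitaryGroup (Fin 2) ℂ),
                  AlphaInputsT3AC.TrivMinimiserRowsT3 F (hF ▸ 𝔠) γ hγ hγ1 a₀ a₁ K Ut ∧
                    AlphaInputsT3AC.DataRowsT3X F (hF ▸ 𝔠) γ hγ hγ1 K Ut)) :
    AlphaInputsT3ACv3Rec L :=
  alphaInputsT3ACv3Rec_of_pinnedPartsRecFL (pinnedPartsT3ACRecFL_of_thm1_rows hL hT hA₀ hA₁ hrows)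

/-- ★★ **THE (FL)-SPLIT FORM**: the registered 2′ text from (T) at any constants, ONE (FL) theorem per record in any constant `B_FL ≤ B₃` («for every record `𝔠` of block size `L`
whose `B₃ ≥ B_FL` (and whatever the supplier box asks), every family `F` with `F.L = L`, every coupling window and run, `InnerFineLiftsT3 F 𝔠 γ hγ hγ1 K 𝔠.B₃`» — the shape the
regional Newton lift delivers through `innerFineLiftsT3_of_regionalLifts` ∕ `innerFineLiftsT3_mono`), and the PLAIN data rows served by NODE O on the same box.  The two
suppliers share the floor `B₀ ≥ B_FL` and the box `(0, A₀] × (0, A₁]`. [cite: Balaban1985Variational, Thm 1 (8) p.279; Balaban1985UV3, (40)–(42) p.266, (68) p.273, Thm 2 p.272] -/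
theorem alphaInputsT3ACv3Rec_of_thm1_fineLifts_dataRows {L : ℕ} (hL : 1 < L)
    (hT : ∃ a₀ a₁ B₃ : ℝ, 0 < a₀ ∧ 0 < a₁ ∧ 0 < B₃ ∧ Thm1GlobalMinAt L a₀ a₁ B₃)
    {B₀ A₀ A₁ : ℝ} (hA₀ : 0 < A₀) (hA₁ : 0 < A₁)
    (hFL : ∀ (𝔠 : AlphaConsts L (suGroupModel 2).N), B₀ ≤ 𝔠.B₃ → 1 ≤ 2 * 𝔠.B₃ →
      4 * 𝔠.B₃ * (L : ℝ) ^ 2 * avgWindowFactor L ≤ 𝔠.C68 → 7 * L + 3 ≤ 𝔠.M₁ →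
      ∀ (F : T3Family) (hF : F.L = L) (γ : ℝ) (hγ : 0 < γ) (hγ1 : γ ≤ (min (hF ▸ 𝔠).gamma0 1) ^ 2) (K : ℕ),
        AlphaInputsT3AC.InnerFineLiftsT3 F (hF ▸ 𝔠) γ hγ hγ1 K (hF ▸ 𝔠).B₃)
    (hrows : ∀ (B a₀ a₁ : ℝ), B₀ ≤ B → 1 ≤ 2 * B → 0 < a₀ → a₀ ≤ A₀ → 0 < a₁ → a₁ ≤ A₁ → B * a₁ ≤ a₀ →
        (143 * ((((3 + 4 : ℕ) : ℝ)) ^ 2 / 4) ^ 2) * (2 * (B * a₁)) ≤ 1 / 3 →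
        2 * (2 * (B * a₁)) ≤ 2 * deltaSU (Fin 2) / (((3 + 4) * L : ℕ) : ℝ) ^ 2 →
        Thm1GlobalMinAt L a₀ a₁ B →
        ∃ (b₁ p₁ : ℝ), ∀ (b₀ p₀ : ℝ), b₁ ≤ b₀ → p₁ ≤ p₀ →
          ∃ 𝔠 : AlphaConsts L (suGroupModel 2).N, 𝔠.b₀ = b₀ ∧ 𝔠.p₀ = p₀ ∧ 𝔠.B₃ = B ∧
            4 * 𝔠.B₃ * (L : ℝ) ^ 2 * avgWindowFactor L ≤ 𝔠.C68 ∧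
            Real.exp (𝔠.p₀ - 1) ≤ 3 * C0 3 * 𝔠.C68 * (𝔠.b₀ * Q0 𝔠.p₀) ∧
            (𝔠.b₀ * Q0 𝔠.p₀) * (2 * (L : ℝ) ^ 2 * avgWindowFactor L) ^ 2 ≤ 3 * C0 3 * 𝔠.C68 * a₁ ^ 2 ∧
            7 * L + 3 ≤ 𝔠.M₁ ∧
            ∀ (F : T3Family) (hF : F.L = L),
              ∀ (γ : ℝ) (hγ : 0 < γ) (hγ1 : γ ≤ (min (hF ▸ 𝔠).gamma0 1) ^ 2) (K : ℕ),
                (∃ Ut : (k : ℕ) → GaugeField (F.P K) k (Matrix.specialUnitaryGroup (Fin 2) ℂ) →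
                    GaugeField (F.P K) 0 (Matrix.specialUnitaryGroup (Fin 2) ℂ),
                  AlphaInputsT3AC.TrivMinimiserRowsT3 F (hF ▸ 𝔠) γ hγ hγ1 a₀ a₁ K Ut) →
                ∃ Ut : (k : ℕ) → GaugeField (F.P K) k (Matrix.specialUnitaryGroup (Fin 2) ℂ) →
                    GaugeField (F.P K) 0 (Matrix.specialUnitaryGroup (Fin 2) ℂ),
                  AlphaInputsT3AC.TrivMinimiserRowsT3 F (hF ▸ 𝔠) γ hγ hγ1 a₀ a₁ K Ut ∧
                    AlphaInputsT3AC.DataRowsT3X F (hF ▸ 𝔠) γ hγ hγ1 K Ut) :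
    AlphaInputsT3ACv3Rec L := by
  refine alphaInputsT3ACv3Rec_of_thm1_rows (B₀ := B₀) hL hT hA₀ hA₁ fun B a₀ a₁ hB h2B ha₀ ha₀A ha₁ ha₁A hwin hA3 hA2 hT1 => ?_
  obtain ⟨b₁, p₁, hrec⟩ := hrows B a₀ a₁ hB h2B ha₀ ha₀A ha₁ ha₁A hwin hA3 hA2 hT1
  refine ⟨b₁, p₁, fun b₀ p₀ hb hp => ?_⟩
  obtain ⟨𝔠, h1, h2, hB3, s1, s2, s3, s4, hO⟩ := hrec b₀ p₀ hb hp
  refine ⟨𝔠, h1, h2, hB3, s1, s2, s3, s4, fun F hF => ⟨?_, hO F hF⟩⟩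
  exact hFL 𝔠 (by rw [hB3]; exact hB) (by rw [hB3]; exact h2B) s1 s4 F hF

end Summit.QuantumFields.YangMills.Theorems.RecordFLOneSupplier

end
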